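import Summits.HodgeConjecture.CorCM.Census.QuaternionColumnFamily
import Summits.HodgeConjecture.CorCM.Census.CoinvariantTypeSum

/-!
# The quaternion column at EVEN level, IV: residual generation mod `2` by the explicit family — every residual type reduces to the two
# diagonal rows of biarcs

COR-CM (cell `pub-hodgecm2`), count-neutral kernel combinatorics by the binder seat b09 (gen 40; lane RELATIVE SPLITTING, part VIII = gen 39ʼs
QUATERNION COLUMN at even level), on gen 39ʼs `Census/QuaternionColumn{Biarc,Circle,Chains,Family}.lean` (`barc`, `fplus`, `rt_a_barc`, `rt_xa_barc`,
`mapDomain_rt_a_fplus`, `mapDomain_rt_xa_fplus`, `chain_identity_a`, `chain_identity_xa`, `gface_top_xa`, `qfam`) and `Census/BaseBlockNearTypes.lean`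
(`residual_cases`), all BY NAME.  Theorems only: no definition, no `decide`, no certificate, no named fact, no `sorry`.
HONEST FRAMING: `HC_CM` is NOT proved, here or anywhere in the tree; nothing here is a period or a headline.

THE POINT (hypothesis (R) of `Census/QuaternionColumnEven(Pivot).lean`, numerically true for `n = 4, …, 12`).  Write `(pair2 (c n) ⊔ Submodule.span (ZMod 2) (translates2 (c n) ((qfam n).image (red (c n))))) = pair2 + 𝔽₂⟨base changes of
red (qfam n)⟩` and call the `4n` biarcs `barc p p`, `barc (p+1) p` the two DIAGONAL ROWS.  For EVERY `n ≥ 3` (no parity, no `2`-power):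
* §1 every biarc face `fplus p q` reduces into `(pair2 (c n) ⊔ Submodule.span (ZMod 2) (translates2 (c n) ((qfam n).image (red (c n)))))` (it is a base change of a member `fplus k 0`, `k < n`, of `qfam n` — along a rotation, or along a
  reflection when `p − q ≥ n`);
* §2 **every biarc** `barc p q` is, modulo `(pair2 (c n) ⊔ Submodule.span (ZMod 2) (translates2 (c n) ((qfam n).image (red (c n)))))`, a sum of diagonal-row biarcs (two-step induction on `p − q` through the biarc faces:
  `[p, p−k−2] ≡ [p−1, p−1−k] + [p, p−1−k] + [p−1, p−2−k]`);
* §3 **every single flip of `T₀ = barc 0 0` and each of its base changes** is, modulo `(pair2 (c n) ⊔ Submodule.span (ZMod 2) (translates2 (c n) ((qfam n).image (red (c n)))))`, a sum of biarcs — by descending induction along gen 39ʼs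
  rotation chain (`chain_identity_a`, ending at the biarc `T₀^{(a(n−1))} = barc (−1) 0`) and reflection chain (`chain_identity_xa`, ending at the top face
  `f'_{n−2}` whose other corners are biarcs, `gface_top_xa`);
* §4 hence EVERY RESIDUAL TYPE (potential `≤ 1`: base changes of `T₀` and of its single flips, `residual_cases`) lies in `(pair2 (c n) ⊔ Submodule.span (ZMod 2) (translates2 (c n) ((qfam n).image (red (c n))))) + 𝔽₂⟨diagonal rows⟩`
  (`single_mem_target_sup_rows_of_bpot_le_one`).
The sequel `Census/QuaternionColumnEvenLaw.lean` shows that a Hodge vector mod `2` supported on the diagonal rows is a sum of pairs (window sliding) and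
concludes (R) and the law `μ(Q_{4n}, c) = φ₂(Q_{4n}, c)` for every even `n ≥ 4`.

## References
* [Pohlmann1968] H. Pohlmann, Algebraic cycles on abelian varieties of complex multiplication type, Ann. of Math. 88 (1968), Thm 1.
-/

namespace Summit.HodgeConjecture.CorCM.Census.QuaternionColumn

open Finset QuaternionGroup
open Summit.HodgeConjecture.CorCM.Prior.AllgGroup.RfwfAllgGroup
open Summit.HodgeConjecture.CorCM.Census.BlockParity
open Summit.HodgeConjecture.CorCM.Census.Coinvariant
open Summit.HodgeConjecture.CorCM.Census.BaseBlock

noncomputable section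

variable {n : ℕ} [NeZero n]

/-! Throughout, the TARGET of the explicit family mod `2` is `pair2 (c n) ⊔ 𝔽₂⟨translates2 (red (qfam n))⟩`, and the DIAGONAL ROWS are the `4n`
biarcs `barc p p`, `barc (p+1) p`; the statements spell both out. -/

/-! ## §1 Base changes of members of `qfam` reduce into the target; every biarc face does -/

/-- The reduction of a base change of a member of `qfam n` lies in the target. [folklore] -/
theorem red_mapDomain_mem_target {f : CMF (QuaternionGroup n) (c n) →₀ ℤ} (hf : f ∈ qfam n) (Q : QuaternionGroup n) :
    red (c n) (Finsupp.mapDomain (rt (c n) Q) f) ∈ (pair2 (c n) ⊔ Submodule.span (ZMod 2) (translates2 (c n) ((qfam n).image (red (c n))))) := by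
  refine Submodule.mem_sup_right (Submodule.subset_span ⟨Q, red (c n) f, mem_image_of_mem _ hf, ?_⟩)
  rw [red_mapDomain]

/-- **Every biarc face reduces into the target** (`n ≥ 1`): `red (fplus p q) ∈ (pair2 (c n) ⊔ Submodule.span (ZMod 2) (translates2 (c n) ((qfam n).image (red (c n)))))` for all `p q`. [folklore] -/
theorem red_fplus_mem_target (p q : ZMod (2 * n)) : red (c n) (fplus p q) ∈ (pair2 (c n) ⊔ Submodule.span (ZMod 2) (translates2 (c n) ((qfam n).image (red (c n))))) := by
  have hn := NeZero.ne n
  set s := p - q with hs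
  by_cases h : s.val < n
  · -- along a rotation: `fplus p q = (fplus s 0)·(a (−q))⁻¹`
    have e : fplus p q = Finsupp.mapDomain (rt (c n) (a (-q))) (fplus ((s.val : ℕ) : ZMod (2 * n)) 0) := by
      rw [mapDomain_rt_a_fplus, ZMod.natCast_zmod_val, hs]; congr 1 <;> ring
    rw [e]
    exact red_mapDomain_mem_target (fplus_mem_qfam s.val h) _
  · -- along a reflection: `p − q = k' + n` with `k' < n`, `fplus p q = (fplus k' 0)·(xa (q + k' − 1))⁻¹`
    have h' : n ≤ s.val := not_lt.mp h
    obtain ⟨k', hk'lt, hk'⟩ : ∃ k' : ℕ, k' < n ∧ s = (k' : ZMod (2 * n)) + (n : ZMod (2 * n)) := by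
      refine ⟨s.val - n, by have := ZMod.val_lt s; omega, ?_⟩
      rw [← Nat.cast_add, Nat.sub_add_cancel h', ZMod.natCast_zmod_val]
    have hp : p = q + (k' : ZMod (2 * n)) + (n : ZMod (2 * n)) := by rw [add_assoc, ← hk', hs]; ring
    have e : fplus p q = Finsupp.mapDomain (rt (c n) (xa (q + (k' : ZMod (2 * n)) - 1))) (fplus (k' : ZMod (2 * n)) 0) := by
      rw [mapDomain_rt_xa_fplus, hp]
      congr 1 <;> ring
    rw [e]
    exact red_mapDomain_mem_target (fplus_mem_qfam k' hk'lt) _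

/-! ## §2 Every biarc reduces to the diagonal rows -/

/-- The diagonal-row biarcs lie in `(pair2 (c n) ⊔ Submodule.span (ZMod 2) (translates2 (c n) ((qfam n).image (red (c n)))) ⊔
      Submodule.span (ZMod 2) ((fun Ψ => Finsupp.single Ψ (1 : ZMod 2)) ''
        {Ψ : CMF (QuaternionGroup n) (c n) | ∃ p : ZMod (2 * n), Ψ = barc p p ∨ Ψ = barc (p + 1) p}))`. [folklore] -/
theorem single_row_mem (p : ZMod (2 * n)) :
    Finsupp.single (barc p p) (1 : ZMod 2) ∈ (pair2 (c n) ⊔ Submodule.span (ZMod 2) (translates2 (c n) ((qfam n).image (red (c n)))) ⊔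
      Submodule.span (ZMod 2) ((fun Ψ => Finsupp.single Ψ (1 : ZMod 2)) ''
        {Ψ : CMF (QuaternionGroup n) (c n) | ∃ p : ZMod (2 * n), Ψ = barc p p ∨ Ψ = barc (p + 1) p})) ∧ Finsupp.single (barc (p + 1) p) (1 : ZMod 2) ∈ (pair2 (c n) ⊔ Submodule.span (ZMod 2) (translates2 (c n) ((qfam n).image (red (c n)))) ⊔
      Submodule.span (ZMod 2) ((fun Ψ => Finsupp.single Ψ (1 : ZMod 2)) ''
        {Ψ : CMF (QuaternionGroup n) (c n) | ∃ p : ZMod (2 * n), Ψ = barc p p ∨ Ψ = barc (p + 1) p})) :=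
  ⟨Submodule.mem_sup_right (Submodule.subset_span ⟨barc p p, ⟨p, Or.inl rfl⟩, rfl⟩),
    Submodule.mem_sup_right (Submodule.subset_span ⟨barc (p + 1) p, ⟨p, Or.inr rfl⟩, rfl⟩)⟩

/-- **Every biarc reduces to the diagonal rows modulo the target**: two-step induction on the difference `k = p − q` through the biarc faces
`fplus (p−1) (p−1−k) = [p−1,p−1−k] + [p,p−k−2] − [p,p−k−1] − [p−1,p−k−2]`. [folklore] -/
theorem single_barc_sub_mem (k : ℕ) : ∀ p : ZMod (2 * n), Finsupp.single (barc p (p - (k : ZMod (2 * n)))) (1 : ZMod 2) ∈ (pair2 (c n) ⊔ Submodule.span (ZMod 2) (translates2 (c n) ((qfam n).image (red (c n)))) ⊔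
      Submodule.span (ZMod 2) ((fun Ψ => Finsupp.single Ψ (1 : ZMod 2)) ''
        {Ψ : CMF (QuaternionGroup n) (c n) | ∃ p : ZMod (2 * n), Ψ = barc p p ∨ Ψ = barc (p + 1) p})) := by
  induction k using Nat.twoStepInduction with
  | zero => intro p; rw [Nat.cast_zero, sub_zero]; exact (single_row_mem p).1
  | one =>
    intro p
    have e : barc p (p - ((1 : ℕ) : ZMod (2 * n))) = barc (p - 1 + 1) (p - 1) := by rw [Nat.cast_one, sub_add_cancel]
    rw [e]; exact (single_row_mem (p - 1)).2
  | more k h0 h1 =>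
    intro p
    have hf := red_fplus_mem_target (n := n) (p - 1) (p - 1 - (k : ZMod (2 * n)))
    rw [fplus_eq, map_sub, map_sub, map_add, red_single, red_single, red_single, red_single, Int.cast_one] at hf
    have e1 : barc (p - 1 + 1) (p - 1 - (k : ZMod (2 * n)) - 1) = barc p (p - ((k + 2 : ℕ) : ZMod (2 * n))) := by
      rw [Nat.cast_add, Nat.cast_two]; congr 1 <;> ring
    have e2 : barc (p - 1 + 1) (p - 1 - (k : ZMod (2 * n))) = barc p (p - ((k + 1 : ℕ) : ZMod (2 * n))) := by
      rw [Nat.cast_add, Nat.cast_one]; congr 1 <;> ring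
    have e3 : barc (p - 1) (p - 1 - (k : ZMod (2 * n)) - 1) = barc (p - 1) (p - 1 - ((k + 1 : ℕ) : ZMod (2 * n))) := by
      rw [Nat.cast_add, Nat.cast_one]; congr 1; ring
    rw [e1, e2, e3] at hf
    -- `[p, p−k−2] = fplus − [p−1,p−1−k] + [p,p−k−1] + [p−1,p−k−2]`
    have e : Finsupp.single (barc p (p - ((k + 2 : ℕ) : ZMod (2 * n)))) (1 : ZMod 2) =
        (Finsupp.single (barc (p - 1) (p - 1 - (k : ZMod (2 * n)))) 1 + Finsupp.single (barc p (p - ((k + 2 : ℕ) : ZMod (2 * n)))) 1 -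
          Finsupp.single (barc p (p - ((k + 1 : ℕ) : ZMod (2 * n)))) 1 -
            Finsupp.single (barc (p - 1) (p - 1 - ((k + 1 : ℕ) : ZMod (2 * n)))) 1) -
          Finsupp.single (barc (p - 1) (p - 1 - (k : ZMod (2 * n)))) 1 + Finsupp.single (barc p (p - ((k + 1 : ℕ) : ZMod (2 * n)))) 1 +
            Finsupp.single (barc (p - 1) (p - 1 - ((k + 1 : ℕ) : ZMod (2 * n)))) 1 := by abel
    rw [e]
    exact Submodule.add_mem _ (Submodule.add_mem _ (Submodule.sub_mem _ (Submodule.mem_sup_left hf) (h0 (p - 1))) (h1 p)) (h1 (p - 1))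

/-- **Every biarc lies in `(pair2 (c n) ⊔ Submodule.span (ZMod 2) (translates2 (c n) ((qfam n).image (red (c n)))) ⊔
      Submodule.span (ZMod 2) ((fun Ψ => Finsupp.single Ψ (1 : ZMod 2)) ''
        {Ψ : CMF (QuaternionGroup n) (c n) | ∃ p : ZMod (2 * n), Ψ = barc p p ∨ Ψ = barc (p + 1) p}))`.** [folklore] -/
theorem single_barc_mem (p q : ZMod (2 * n)) : Finsupp.single (barc p q) (1 : ZMod 2) ∈ (pair2 (c n) ⊔ Submodule.span (ZMod 2) (translates2 (c n) ((qfam n).image (red (c n)))) ⊔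
      Submodule.span (ZMod 2) ((fun Ψ => Finsupp.single Ψ (1 : ZMod 2)) ''
        {Ψ : CMF (QuaternionGroup n) (c n) | ∃ p : ZMod (2 * n), Ψ = barc p p ∨ Ψ = barc (p + 1) p})) := by
  have h := single_barc_sub_mem (n := n) (p - q).val p
  rwa [ZMod.natCast_zmod_val, sub_sub_cancel] at h

/-- Every base change of a biarc is a biarc, hence lies in `(pair2 (c n) ⊔ Submodule.span (ZMod 2) (translates2 (c n) ((qfam n).image (red (c n)))) ⊔
      Submodule.span (ZMod 2) ((fun Ψ => Finsupp.single Ψ (1 : ZMod 2)) ''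
        {Ψ : CMF (QuaternionGroup n) (c n) | ∃ p : ZMod (2 * n), Ψ = barc p p ∨ Ψ = barc (p + 1) p}))`. [folklore] -/
theorem single_rt_barc_mem (Q : QuaternionGroup n) (p q : ZMod (2 * n)) : Finsupp.single (rt (c n) Q (barc p q)) (1 : ZMod 2) ∈ (pair2 (c n) ⊔ Submodule.span (ZMod 2) (translates2 (c n) ((qfam n).image (red (c n)))) ⊔
      Submodule.span (ZMod 2) ((fun Ψ => Finsupp.single Ψ (1 : ZMod 2)) ''
        {Ψ : CMF (QuaternionGroup n) (c n) | ∃ p : ZMod (2 * n), Ψ = barc p p ∨ Ψ = barc (p + 1) p})) := by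
  cases Q with
  | a k => rw [rt_a_barc]; exact single_barc_mem _ _
  | xa k => rw [rt_xa_barc]; exact single_barc_mem _ _

/-! ## §3 The single flips of `T₀` and their base changes reduce to biarcs: the two chains -/

/-- The link step: if the base changes of `Ψ'` lie in `(pair2 (c n) ⊔ Submodule.span (ZMod 2) (translates2 (c n) ((qfam n).image (red (c n)))) ⊔
      Submodule.span (ZMod 2) ((fun Ψ => Finsupp.single Ψ (1 : ZMod 2)) ''
        {Ψ : CMF (QuaternionGroup n) (c n) | ∃ p : ZMod (2 * n), Ψ = barc p p ∨ Ψ = barc (p + 1) p}))` and `[Ψ] − [Ψ'·(a 1)⁻¹] = ([T₀] − [T₀·(a 1)⁻¹]) − f + c'·(a 1)⁻¹` with `f, c' ∈ qfam n`, then the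
base changes of `Ψ` lie in `(pair2 (c n) ⊔ Submodule.span (ZMod 2) (translates2 (c n) ((qfam n).image (red (c n)))) ⊔
      Submodule.span (ZMod 2) ((fun Ψ => Finsupp.single Ψ (1 : ZMod 2)) ''
        {Ψ : CMF (QuaternionGroup n) (c n) | ∃ p : ZMod (2 * n), Ψ = barc p p ∨ Ψ = barc (p + 1) p}))`. [folklore] -/
theorem single_rt_mem_of_link {Ψ Ψ' : CMF (QuaternionGroup n) (c n)} {f g : CMF (QuaternionGroup n) (c n) →₀ ℤ}
    (hf : f ∈ qfam n) (hg : g ∈ qfam n)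
    (hid : Finsupp.single Ψ (1 : ℤ) - Finsupp.single (rt (c n) (a 1) Ψ') 1 =
      (Finsupp.single (barc (0 : ZMod (2 * n)) 0) (1 : ℤ) - Finsupp.single (rt (c n) (a 1) (barc 0 0)) 1) - f +
        Finsupp.mapDomain (rt (c n) (a 1)) g)
    (hΨ' : ∀ Q : QuaternionGroup n, Finsupp.single (rt (c n) Q Ψ') (1 : ZMod 2) ∈ (pair2 (c n) ⊔ Submodule.span (ZMod 2) (translates2 (c n) ((qfam n).image (red (c n)))) ⊔
      Submodule.span (ZMod 2) ((fun Ψ => Finsupp.single Ψ (1 : ZMod 2)) ''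
        {Ψ : CMF (QuaternionGroup n) (c n) | ∃ p : ZMod (2 * n), Ψ = barc p p ∨ Ψ = barc (p + 1) p}))) (Q : QuaternionGroup n) :
    Finsupp.single (rt (c n) Q Ψ) (1 : ZMod 2) ∈ (pair2 (c n) ⊔ Submodule.span (ZMod 2) (translates2 (c n) ((qfam n).image (red (c n)))) ⊔
      Submodule.span (ZMod 2) ((fun Ψ => Finsupp.single Ψ (1 : ZMod 2)) ''
        {Ψ : CMF (QuaternionGroup n) (c n) | ∃ p : ZMod (2 * n), Ψ = barc p p ∨ Ψ = barc (p + 1) p})) := by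
  have h := congrArg (fun v => red (c n) (Finsupp.mapDomain (rt (c n) Q) v)) hid
  simp only [Finsupp.mapDomain_sub, Finsupp.mapDomain_add, Finsupp.mapDomain_single, map_sub, map_add, red_single, Int.cast_one,
    ← mapDomain_rt_mul, ← rt_mul] at h
  have e : Finsupp.single (rt (c n) Q Ψ) (1 : ZMod 2) =
      (Finsupp.single (rt (c n) Q Ψ) 1 - Finsupp.single (rt (c n) (Q * a 1) Ψ') 1) + Finsupp.single (rt (c n) (Q * a 1) Ψ') 1 := by abel
  rw [e, h]
  refine Submodule.add_mem _ (Submodule.add_mem _ (Submodule.sub_mem _ (Submodule.sub_mem _ ?_ ?_) ?_) ?_) (hΨ' _)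
  · exact single_rt_barc_mem _ _ _
  · exact single_rt_barc_mem _ _ _
  · exact Submodule.mem_sup_left (red_mapDomain_mem_target hf Q)
  · exact Submodule.mem_sup_left (red_mapDomain_mem_target hg (Q * a 1))

/-- **The rotation chain**: every base change of every rotation flip `T₀^{(a i)}` (`i < n`) lies in `(pair2 (c n) ⊔ Submodule.span (ZMod 2) (translates2 (c n) ((qfam n).image (red (c n)))) ⊔
      Submodule.span (ZMod 2) ((fun Ψ => Finsupp.single Ψ (1 : ZMod 2)) ''
        {Ψ : CMF (QuaternionGroup n) (c n) | ∃ p : ZMod (2 * n), Ψ = barc p p ∨ Ψ = barc (p + 1) p}))` (`n ≥ 3`; descending induction from the biarc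
`T₀^{(a (n−1))} = barc (−1) 0` along `chain_identity_a`, then `T₀^{(a 0)} = barc 1 0`). [folklore] -/
theorem single_rt_oflip_a_mem (h3 : 3 ≤ n) (i : ℕ) (hi : i < n) (Q : QuaternionGroup n) :
    Finsupp.single (rt (c n) Q (oflipCM (c n) c_mul_c (a (i : ZMod (2 * n))) (barc (0 : ZMod (2 * n)) 0))) (1 : ZMod 2) ∈ (pair2 (c n) ⊔ Submodule.span (ZMod 2) (translates2 (c n) ((qfam n).image (red (c n)))) ⊔
      Submodule.span (ZMod 2) ((fun Ψ => Finsupp.single Ψ (1 : ZMod 2)) ''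
        {Ψ : CMF (QuaternionGroup n) (c n) | ∃ p : ZMod (2 * n), Ψ = barc p p ∨ Ψ = barc (p + 1) p})) := by
  -- descending induction: `P d` = the claim for `i = n − 1 − d`, `d ≤ n − 2`
  have key : ∀ d : ℕ, d ≤ n - 2 → ∀ Q : QuaternionGroup n,
      Finsupp.single (rt (c n) Q (oflipCM (c n) c_mul_c (a ((n - 1 - d : ℕ) : ZMod (2 * n))) (barc (0 : ZMod (2 * n)) 0))) (1 : ZMod 2) ∈ (pair2 (c n) ⊔ Submodule.span (ZMod 2) (translates2 (c n) ((qfam n).image (red (c n)))) ⊔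
      Submodule.span (ZMod 2) ((fun Ψ => Finsupp.single Ψ (1 : ZMod 2)) ''
        {Ψ : CMF (QuaternionGroup n) (c n) | ∃ p : ZMod (2 * n), Ψ = barc p p ∨ Ψ = barc (p + 1) p})) := by
    intro d
    induction d with
    | zero =>
      intro _ Q
      have e : oflipCM (c n) c_mul_c (a ((n - 1 - 0 : ℕ) : ZMod (2 * n))) (barc (0 : ZMod (2 * n)) 0) = barc (-1) 0 := by
        have hc : (a ((n - 1 - 0 : ℕ) : ZMod (2 * n)) : QuaternionGroup n) = c n * a (-1) := by
          rw [(c_mul_a _).1, Nat.sub_zero, Nat.cast_sub (by omega), Nat.cast_one]; congr 1; ring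
        rw [hc, oflipCM_cmul, oflipCM_ends.2.1]
      rw [e]; exact single_rt_barc_mem _ _ _
    | succ d ih =>
      intro hd Q
      have hi1 : 1 ≤ n - 1 - (d + 1) := by omega
      have hi2 : n - 1 - (d + 1) + 2 ≤ n := by omega
      refine single_rt_mem_of_link (f_mem_qfam _ hi1 hi2) (c_mem_qfam _ hi1 hi2) (chain_identity_a _) (fun Q' => ?_) Q
      have e : ((n - 1 - (d + 1) : ℕ) : ZMod (2 * n)) + 1 = ((n - 1 - d : ℕ) : ZMod (2 * n)) := by
        rw [← Nat.cast_succ]; congr 1; omega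
      rw [e]; exact ih (by omega) Q'
  by_cases h0 : i = 0
  · subst h0
    rw [Nat.cast_zero, oflipCM_ends.1]
    exact single_rt_barc_mem _ _ _
  · have e : (i : ZMod (2 * n)) = ((n - 1 - (n - 1 - i) : ℕ) : ZMod (2 * n)) := by congr 1; omega
    rw [e]; exact key (n - 1 - i) (by omega) Q

/-- **The reflection chain**: every base change of every reflection flip `T₀^{(xa j)}` (`j < n`) lies in `(pair2 (c n) ⊔ Submodule.span (ZMod 2) (translates2 (c n) ((qfam n).image (red (c n)))) ⊔
      Submodule.span (ZMod 2) ((fun Ψ => Finsupp.single Ψ (1 : ZMod 2)) ''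
        {Ψ : CMF (QuaternionGroup n) (c n) | ∃ p : ZMod (2 * n), Ψ = barc p p ∨ Ψ = barc (p + 1) p}))` (`n ≥ 3`; the top flip `T₀^{(xa (n−2))}`
through `gface_top_xa`, descending induction along `chain_identity_xa`, and the two biarc ends `xa 0`, `xa (n−1)`). [folklore] -/
theorem single_rt_oflip_xa_mem (h3 : 3 ≤ n) (j : ℕ) (hj : j < n) (Q : QuaternionGroup n) :
    Finsupp.single (rt (c n) Q (oflipCM (c n) c_mul_c (xa (j : ZMod (2 * n))) (barc (0 : ZMod (2 * n)) 0))) (1 : ZMod 2) ∈ (pair2 (c n) ⊔ Submodule.span (ZMod 2) (translates2 (c n) ((qfam n).image (red (c n)))) ⊔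
      Submodule.span (ZMod 2) ((fun Ψ => Finsupp.single Ψ (1 : ZMod 2)) ''
        {Ψ : CMF (QuaternionGroup n) (c n) | ∃ p : ZMod (2 * n), Ψ = barc p p ∨ Ψ = barc (p + 1) p})) := by
  -- the top flip `j = n − 2`
  have htop : ∀ Q : QuaternionGroup n,
      Finsupp.single (rt (c n) Q (oflipCM (c n) c_mul_c (xa ((n : ZMod (2 * n)) - 2)) (barc (0 : ZMod (2 * n)) 0))) (1 : ZMod 2) ∈ (pair2 (c n) ⊔ Submodule.span (ZMod 2) (translates2 (c n) ((qfam n).image (red (c n)))) ⊔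
      Submodule.span (ZMod 2) ((fun Ψ => Finsupp.single Ψ (1 : ZMod 2)) ''
        {Ψ : CMF (QuaternionGroup n) (c n) | ∃ p : ZMod (2 * n), Ψ = barc p p ∨ Ψ = barc (p + 1) p})) := by
    intro Q
    have hf : gface (c n) c_mul_c (barc (0 : ZMod (2 * n)) 0) (xa ((n : ZMod (2 * n)) - 2)) (xa (-1)) ∈ qfam n := by
      have e : ((n : ZMod (2 * n)) - 2) = ((n - 2 : ℕ) : ZMod (2 * n)) := by rw [Nat.cast_sub (by omega), Nat.cast_two]
      rw [e]; exact f'_mem_qfam (n - 2) (by omega) (by omega)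
    have h := congrArg (fun v => red (c n) (Finsupp.mapDomain (rt (c n) Q) v)) (gface_top_xa (n := n))
    have hT := red_mapDomain_mem_target hf Q
    simp only [Finsupp.mapDomain_sub, Finsupp.mapDomain_add, Finsupp.mapDomain_single, map_sub, map_add, red_single, Int.cast_one] at h
    rw [h] at hT
    -- `[V·Q⁻¹] = [T₀·Q⁻¹] + [barc 0 (−2)·Q⁻¹] − [barc 0 (−1)·Q⁻¹] − (top face·Q⁻¹)`
    have e : Finsupp.single (rt (c n) Q (oflipCM (c n) c_mul_c (xa ((n : ZMod (2 * n)) - 2)) (barc (0 : ZMod (2 * n)) 0))) (1 : ZMod 2) =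
        Finsupp.single (rt (c n) Q (barc 0 0)) 1 + Finsupp.single (rt (c n) Q (barc 0 (-2))) 1 - Finsupp.single (rt (c n) Q (barc 0 (-1))) 1 -
          (Finsupp.single (rt (c n) Q (barc 0 0)) 1 + Finsupp.single (rt (c n) Q (barc 0 (-2))) 1 -
            Finsupp.single (rt (c n) Q (oflipCM (c n) c_mul_c (xa ((n : ZMod (2 * n)) - 2)) (barc 0 0))) 1 -
              Finsupp.single (rt (c n) Q (barc 0 (-1))) 1) := by abel
    rw [e]
    exact Submodule.sub_mem _ (Submodule.sub_mem _ (Submodule.add_mem _ (single_rt_barc_mem _ _ _) (single_rt_barc_mem _ _ _))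
      (single_rt_barc_mem _ _ _)) (Submodule.mem_sup_left hT)
  -- descending induction from the top: `j = n − 2 − d`, `d ≤ n − 3`
  have key : ∀ d : ℕ, d ≤ n - 3 → ∀ Q : QuaternionGroup n,
      Finsupp.single (rt (c n) Q (oflipCM (c n) c_mul_c (xa ((n - 2 - d : ℕ) : ZMod (2 * n))) (barc (0 : ZMod (2 * n)) 0))) (1 : ZMod 2) ∈ (pair2 (c n) ⊔ Submodule.span (ZMod 2) (translates2 (c n) ((qfam n).image (red (c n)))) ⊔
      Submodule.span (ZMod 2) ((fun Ψ => Finsupp.single Ψ (1 : ZMod 2)) ''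
        {Ψ : CMF (QuaternionGroup n) (c n) | ∃ p : ZMod (2 * n), Ψ = barc p p ∨ Ψ = barc (p + 1) p})) := by
    intro d
    induction d with
    | zero =>
      intro _ Q
      have e : ((n - 2 - 0 : ℕ) : ZMod (2 * n)) = (n : ZMod (2 * n)) - 2 := by rw [Nat.sub_zero, Nat.cast_sub (by omega), Nat.cast_two]
      rw [e]; exact htop Q
    | succ d ih =>
      intro hd Q
      have hj1 : 1 ≤ n - 2 - (d + 1) := by omega
      refine single_rt_mem_of_link (f'_mem_qfam _ hj1 (by omega)) (c'_mem_qfam _ hj1 (by omega)) (chain_identity_xa _) (fun Q' => ?_) Q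
      have e : ((n - 2 - (d + 1) : ℕ) : ZMod (2 * n)) + 1 = ((n - 2 - d : ℕ) : ZMod (2 * n)) := by
        rw [← Nat.cast_succ]; congr 1; omega
      rw [e]; exact ih (by omega) Q'
  by_cases h0 : j = 0
  · subst h0
    rw [Nat.cast_zero, oflipCM_ends.2.2.1]
    exact single_rt_barc_mem _ _ _
  by_cases hl : j = n - 1
  · subst hl
    have hc : (xa ((n - 1 : ℕ) : ZMod (2 * n)) : QuaternionGroup n) = c n * xa (-1) := by
      rw [(c_mul_a _).2, Nat.cast_sub (by omega), Nat.cast_one]; congr 1; ring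
    rw [hc, oflipCM_cmul, oflipCM_ends.2.2.2]
    exact single_rt_barc_mem _ _ _
  · have e : (j : ZMod (2 * n)) = ((n - 2 - (n - 2 - j) : ℕ) : ZMod (2 * n)) := by congr 1; omega
    rw [e]; exact key (n - 2 - j) (by omega) Q

/-! ## §4 Every residual type reduces to the diagonal rows modulo the target -/

/-- **EVERY RESIDUAL TYPE LIES IN `(pair2 (c n) ⊔ Submodule.span (ZMod 2) (translates2 (c n) ((qfam n).image (red (c n))))) + 𝔽₂⟨diagonal rows⟩`** (`n ≥ 3`): the types of potential `≤ 1` w.r.t. `T₀ = barc 0 0` are the base changes of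
`T₀` and of its single flips (`BaseBlock.residual_cases`). [folklore] -/
theorem single_mem_target_sup_rows_of_bpot_le_one (h3 : 3 ≤ n) {Ψ : CMF (QuaternionGroup n) (c n)}
    (hΨ : bpot (c n) (barc (0 : ZMod (2 * n)) 0) Ψ ≤ 1) : Finsupp.single Ψ (1 : ZMod 2) ∈ (pair2 (c n) ⊔ Submodule.span (ZMod 2) (translates2 (c n) ((qfam n).image (red (c n)))) ⊔
      Submodule.span (ZMod 2) ((fun Ψ => Finsupp.single Ψ (1 : ZMod 2)) ''
        {Ψ : CMF (QuaternionGroup n) (c n) | ∃ p : ZMod (2 * n), Ψ = barc p p ∨ Ψ = barc (p + 1) p})) := by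
  have hn := NeZero.ne n
  rcases residual_cases (c n) (barc (0 : ZMod (2 * n)) 0) c_mul_c hΨ with ⟨Q, rfl⟩ | ⟨Q, s, hs, rfl⟩
  · exact single_rt_barc_mem _ _ _
  · cases s with
    | a i =>
      rw [a_mem_barc, sub_zero] at hs
      have e : (i : ZMod (2 * n)) = ((i.val : ℕ) : ZMod (2 * n)) := (ZMod.natCast_zmod_val i).symm
      rw [e]; exact single_rt_oflip_a_mem h3 i.val hs Q
    | xa j =>
      rw [xa_mem_barc, sub_zero] at hs
      have e : (j : ZMod (2 * n)) = ((j.val : ℕ) : ZMod (2 * n)) := (ZMod.natCast_zmod_val j).symm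
      rw [e]; exact single_rt_oflip_xa_mem h3 j.val hs Q

end

end Summit.HodgeConjecture.CorCM.Census.QuaternionColumn
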